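import Summits.PneNP.PneNP.Theses.RamseyAliens

/-!
# Route RamseyAliens — `ErdosSzekeres` (stmt-PneNP-2283)

Erdős–Szekeres 1935, diagonal case: every graph on `4^k` vertices has a `k`-clique or a `k`-independent set
(`R(k,k) ≤ C(2k−2, k−1) ≤ 4^k`). Classical induction `R(a+1,b+1) ≤ C(a+b, a)` via the neighbourhood pigeonhole at a
vertex (`ramsey_finset`), stated on finsets of an ambient vertex type so that no induced subgraphs are needed.
-/

set_option linter.dupNamespace false -- `Summit.PneNP.PneNP.…`: summit = sub-problem name (D-0017 single-conjunct layout)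

namespace Summit.PneNP.PneNP.Theorems

/-- **Erdős–Szekeres recursion on finsets**: inside any vertex set `A` with `C(a+b, a) ≤ |A|` there is an `(a+1)`-clique of
`G` or a `(b+1)`-clique of `Gᶜ`. [cite: ErdosSzekeres1935, §1] -/
theorem ramsey_finset {V : Type*} [DecidableEq V] (G : SimpleGraph V) :
    ∀ (n a b : ℕ), a + b = n → ∀ A : Finset V, (a + b).choose a ≤ A.card →
      (∃ S ⊆ A, G.IsNClique (a + 1) S) ∨ (∃ T ⊆ A, Gᶜ.IsNClique (b + 1) T) := by
  classical
  intro n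
  induction n with
  | zero =>
    intro a b hab A hA
    obtain rfl : a = 0 := by omega
    obtain rfl : b = 0 := by omega
    simp only [add_zero, Nat.choose_self] at hA
    obtain ⟨v, hv⟩ := Finset.card_pos.1 hA
    exact Or.inl ⟨{v}, by simpa using hv, SimpleGraph.isNClique_one.2 ⟨v, rfl⟩⟩
  | succ n ih =>
    intro a b hab A hA
    cases a with
    | zero =>
      simp only [zero_add, Nat.choose_zero_right] at hA
      obtain ⟨v, hv⟩ := Finset.card_pos.1 hA
      exact Or.inl ⟨{v}, by simpa using hv, SimpleGraph.isNClique_one.2 ⟨v, rfl⟩⟩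
    | succ a =>
      cases b with
      | zero =>
        simp only [add_zero, Nat.choose_self] at hA
        obtain ⟨v, hv⟩ := Finset.card_pos.1 hA
        exact Or.inr ⟨{v}, by simpa using hv, SimpleGraph.isNClique_one.2 ⟨v, rfl⟩⟩
      | succ b =>
        -- Pascal: C(a+b+2, a+1) = C(a+b+1, a) + C(a+b+1, a+1)
        have hpas : (a + 1 + (b + 1)).choose (a + 1) = (a + b + 1).choose a + (a + b + 1).choose (a + 1) := by
          rw [show a + 1 + (b + 1) = (a + b + 1) + 1 by ring, Nat.choose_succ_succ]
        have hpos : 0 < A.card := lt_of_lt_of_le (Nat.choose_pos (by omega)) hA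
        obtain ⟨v, hv⟩ := Finset.card_pos.1 hpos
        set Nv := (A.erase v).filter (fun w => G.Adj v w) with hNv
        set Mv := (A.erase v).filter (fun w => ¬ G.Adj v w) with hMv
        have hsum : Nv.card + Mv.card = A.card - 1 := by
          rw [hNv, hMv, Finset.card_filter_add_card_filter_not, Finset.card_erase_of_mem hv]
        have hNA : Nv ⊆ A := (Finset.filter_subset _ _).trans (Finset.erase_subset _ _)
        have hMA : Mv ⊆ A := (Finset.filter_subset _ _).trans (Finset.erase_subset _ _)
        by_cases hcase : (a + b + 1).choose a ≤ Nv.card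
        · -- recurse in the neighbourhood with (a, b+1)
          rcases ih a (b + 1) (by omega) Nv (by rwa [show a + (b + 1) = a + b + 1 by ring]) with
            ⟨S, hS, hcl⟩ | ⟨T, hT, hcl⟩
          · refine Or.inl ⟨insert v S, Finset.insert_subset hv (hS.trans hNA), ?_⟩
            refine hcl.insert fun w hw => ?_
            have := hS hw
            rw [hNv, Finset.mem_filter] at this
            exact this.2
          · exact Or.inr ⟨T, hT.trans hNA, hcl⟩
        · have hcase' : (a + b + 1).choose (a + 1) ≤ Mv.card := by
            push Not at hcase
            omega
          -- recurse in the non-neighbourhood with (a+1, b)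
          rcases ih (a + 1) b (by omega) Mv (by rwa [show a + 1 + b = a + b + 1 by ring]) with
            ⟨S, hS, hcl⟩ | ⟨T, hT, hcl⟩
          · exact Or.inl ⟨S, hS.trans hMA, hcl⟩
          · refine Or.inr ⟨insert v T, Finset.insert_subset hv (hT.trans hMA), ?_⟩
            refine hcl.insert fun w hw => ?_
            have := hT hw
            rw [hMv, Finset.mem_filter, Finset.mem_erase] at this
            rw [SimpleGraph.compl_adj]
            exact ⟨fun h => this.1.1 h.symm, this.2⟩

/-- **Support item `ErdosSzekeres` of route RamseyAliens (stmt-PneNP-2283)**: every graph on `4^k` vertices has a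
`k`-clique or a `k`-independent set (`R(k,k) ≤ C(2k−2,k−1) ≤ 2^{2k−2} ≤ 4^k`). [cite: ErdosSzekeres1935, §1] -/
theorem ramseyAliens_erdosSzekeres_proof : Summit.PneNP.PneNP.Theses.RamseyAliens.ErdosSzekeres := by
  unfold Summit.PneNP.PneNP.Theses.RamseyAliens.ErdosSzekeres
  intro k G
  cases k with
  | zero =>
    left
    intro h
    exact h ∅ ⟨by simp, rfl⟩
  | succ k =>
    have hbound : (k + k).choose k ≤ (Finset.univ : Finset (Fin (4 ^ (k + 1)))).card := by
      rw [Finset.card_univ, Fintype.card_fin]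
      calc (k + k).choose k ≤ 2 ^ (k + k) := Nat.choose_le_two_pow _ _
        _ = 4 ^ k := by rw [← two_mul, pow_mul]; norm_num
        _ ≤ 4 ^ (k + 1) := Nat.pow_le_pow_right (by norm_num) (by omega)
    rcases ramsey_finset G (k + k) k k rfl Finset.univ hbound with ⟨S, -, hS⟩ | ⟨T, -, hT⟩
    · exact Or.inl fun h => h S hS
    · exact Or.inr fun h => h T hT

end Summit.PneNP.PneNP.Theorems
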